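import Mathlib.Analysis.MellinTransform
import Mathlib.Analysis.SpecialFunctions.Pow.Deriv
import Mathlib.Analysis.SpecialFunctions.Integrals.Basic
import Mathlib.MeasureTheory.Integral.IntegralEqImproper
import Literature.NumberTheory.LFunctions.MellinVanishingIntegral
import HarnessLib

/-!
# One integration by parts in the Mellin transform

For `Re w > 0`:

* if `f` is continuous on `[0, A]`, differentiable on `(0, A)` with integrable derivative `f'`, and vanishes
  on `(A, ∞)` (a jump at `A` is allowed), then
  `w · 𝓜f(w) = f(A) A^w − ∫_0^A f'(x) x^w dx` (`mul_mellin_eq_sub_integral_deriv`), whence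
  `‖w · 𝓜f(w)‖ ≤ |f(A)| A^{Re w} + ∫_0^A |f'(x)| x^{Re w} dx`;
* if `f` is differentiable on `(0, ∞)`, continuous at `0⁺`, `𝓜f(w)` converges absolutely, `f' x^w` is
  integrable and `f(x) x^{Re w} → 0` at `∞`, then `w · 𝓜f(w) = −∫_0^∞ f'(x) x^w dx`
  (`mul_mellin_eq_neg_integral_deriv`), whence `‖w · 𝓜f(w)‖ ≤ ∫_0^∞ |f'(x)| x^{Re w} dx`.

The point, for the analysis of Connes' Fact 6.4 (file `ConnesProlateGuessError.lean`): the gain of the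
factor `w` makes `ζ(w)·𝓜g(w) = (ζ(w)/w)·(w 𝓜g(w))` uniformly controllable in `Im w` on a closed substrip
of `0 < Re w < 1`, since `ζ(w)/w` is bounded there while `ζ(w)` is not.  Elementary real analysis
(fundamental theorem of calculus on `[0, A]` and on `[0, ∞)`); nothing here concerns `ζ`.
-/

open Real Complex Set MeasureTheory Filter Topology intervalIntegral

namespace Literature.NumberTheory.LFunctions

/-- Derivative of `x ↦ f(x)·x^w` on `x > 0` for real `f`. [folklore] -/
theorem hasDerivAt_ofReal_mul_cpow {f f' : ℝ → ℝ} {x : ℝ} (hx : 0 < x) (hf : HasDerivAt f (f' x) x)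
    (w : ℂ) :
    HasDerivAt (fun y : ℝ ↦ (f y : ℂ) * (y : ℂ) ^ w)
      ((f' x : ℂ) * (x : ℂ) ^ w + (f x : ℂ) * (w * (x : ℂ) ^ (w - 1))) x := by
  have h1 : HasDerivAt (fun y : ℝ ↦ (f y : ℂ)) (f' x : ℂ) x := hf.ofReal_comp
  have h2 : HasDerivAt (fun y : ℝ ↦ (y : ℂ) ^ w) (w * (x : ℂ) ^ (w - 1)) x := by
    have h : HasStrictDerivAt (fun z : ℂ ↦ z ^ w) (w * (x : ℂ) ^ (w - 1)) (x : ℂ) :=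
      Complex.hasStrictDerivAt_cpow_const (Or.inl (by exact_mod_cast hx))
    exact h.hasDerivAt.comp_ofReal
  exact h1.mul h2

/-- **Mellin integration by parts, compact support.**  `f` continuous on `[0,A]`, differentiable on
`(0,A)` with `f'` integrable there, `f = 0` on `(A,∞)`, `Re w > 0`:
`w·𝓜f(w) = f(A)·A^w − ∫_0^A f'(x) x^w dx`. [folklore] -/
theorem mul_mellin_eq_sub_integral_deriv {f f' : ℝ → ℝ} {A : ℝ} (hA : 0 < A)
    (hcont : ContinuousOn f (Icc 0 A)) (hderiv : ∀ x ∈ Ioo 0 A, HasDerivAt f (f' x) x)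
    (hf' : IntervalIntegrable f' volume 0 A) (hsupp : ∀ x, A < x → f x = 0) {w : ℂ}
    (hw : 0 < w.re) :
    w * mellin (fun x ↦ (f x : ℂ)) w =
      (f A : ℂ) * (A : ℂ) ^ w - ∫ x in (0 : ℝ)..A, (f' x : ℂ) * (x : ℂ) ^ w := by
  have hw0 : w ≠ 0 := by
    rintro rfl
    simp at hw
  -- the Mellin integral lives on `(0, A]`
  have hconv : IntegrableOn (fun x : ℝ ↦ (x : ℂ) ^ (w - 1) • (f x : ℂ)) (Ioi 0) :=
    mellinConvergent_ofReal_of_continuousOn hA hcont hsupp hw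
  have hmel : mellin (fun x ↦ (f x : ℂ)) w =
      ∫ x in (0 : ℝ)..A, (f x : ℂ) * (w * (x : ℂ) ^ (w - 1)) / w := by
    rw [mellin]
    have hzero : ∀ x ∈ Ioi (0 : ℝ) \ Ioc 0 A, (x : ℂ) ^ (w - 1) • ((f x : ℝ) : ℂ) = 0 := by
      intro x hx
      have hxA : A < x := by
        by_contra h
        exact hx.2 ⟨hx.1, not_lt.mp h⟩
      simp [hsupp x hxA]
    rw [setIntegral_eq_of_subset_of_forall_sdiff_eq_zero measurableSet_Ioi Ioc_subset_Ioi_self hzero,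
      ← integral_of_le hA.le]
    refine integral_congr fun x _ ↦ ?_
    simp only [smul_eq_mul]
    field_simp
  -- fundamental theorem of calculus for `F(x) = f(x) x^w` on `[0, A]`
  have hFcont : ContinuousOn (fun x : ℝ ↦ (f x : ℂ) * (x : ℂ) ^ w) (Icc 0 A) :=
    (Complex.continuous_ofReal.comp_continuousOn hcont).mul
      (Complex.continuous_ofReal_cpow_const hw).continuousOn
  have hFderiv : ∀ x ∈ Ioo 0 A, HasDerivAt (fun y : ℝ ↦ (f y : ℂ) * (y : ℂ) ^ w)
      ((f' x : ℂ) * (x : ℂ) ^ w + (f x : ℂ) * (w * (x : ℂ) ^ (w - 1))) x :=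
    fun x hx ↦ hasDerivAt_ofReal_mul_cpow hx.1 (hderiv x hx) w
  have hI1 : IntervalIntegrable (fun x : ℝ ↦ (f' x : ℂ) * (x : ℂ) ^ w) volume 0 A := by
    have h1 : IntervalIntegrable (fun x : ℝ ↦ (f' x : ℂ)) volume 0 A := ⟨hf'.1.ofReal, hf'.2.ofReal⟩
    exact h1.mul_continuousOn ((Complex.continuous_ofReal_cpow_const hw).continuousOn)
  have hI2 : IntervalIntegrable (fun x : ℝ ↦ (f x : ℂ) * (w * (x : ℂ) ^ (w - 1))) volume 0 A := by
    rw [intervalIntegrable_iff_integrableOn_Ioc_of_le hA.le]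
    refine ((hconv.mono_set Ioc_subset_Ioi_self).const_mul w).congr (ae_of_all _ fun x ↦ ?_)
    simp only [smul_eq_mul]
    ring
  have hFTC := integral_eq_sub_of_hasDerivAt_of_le hA.le hFcont hFderiv (hI1.add hI2)
  simp only [Complex.ofReal_zero, Complex.zero_cpow hw0, mul_zero, sub_zero] at hFTC
  rw [integral_add hI1 hI2] at hFTC
  -- assemble
  have h2 : ∫ x in (0 : ℝ)..A, (f x : ℂ) * (w * (x : ℂ) ^ (w - 1)) =
      w * mellin (fun x ↦ (f x : ℂ)) w := by
    rw [hmel, intervalIntegral.integral_div, mul_div_cancel₀ _ hw0]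
  rw [← h2]
  linear_combination hFTC

/-- Norm form of `mul_mellin_eq_sub_integral_deriv`:
`‖w·𝓜f(w)‖ ≤ |f(A)| A^{Re w} + ∫_0^A |f'(x)| x^{Re w} dx`. [folklore] -/
theorem norm_mul_mellin_le_of_hasDerivAt {f f' : ℝ → ℝ} {A : ℝ} (hA : 0 < A)
    (hcont : ContinuousOn f (Icc 0 A)) (hderiv : ∀ x ∈ Ioo 0 A, HasDerivAt f (f' x) x)
    (hf' : IntervalIntegrable f' volume 0 A) (hsupp : ∀ x, A < x → f x = 0) {w : ℂ}
    (hw : 0 < w.re) :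
    ‖w * mellin (fun x ↦ (f x : ℂ)) w‖ ≤
      |f A| * A ^ w.re + ∫ x in (0 : ℝ)..A, |f' x| * x ^ w.re := by
  rw [mul_mellin_eq_sub_integral_deriv hA hcont hderiv hf' hsupp hw]
  have hnorm : ∀ x : ℝ, 0 ≤ x → ‖(f' x : ℂ) * (x : ℂ) ^ w‖ = |f' x| * x ^ w.re := fun x hx ↦ by
    rw [norm_mul, Complex.norm_real, Real.norm_eq_abs,
      Complex.norm_cpow_eq_rpow_re_of_nonneg hx hw.ne']
  refine (norm_sub_le _ _).trans (add_le_add ?_ ?_)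
  · rw [norm_mul, Complex.norm_real, Real.norm_eq_abs,
      Complex.norm_cpow_eq_rpow_re_of_pos hA]
  · refine (intervalIntegral.norm_integral_le_integral_norm hA.le).trans (le_of_eq ?_)
    refine integral_congr fun x hx ↦ hnorm x ?_
    rw [uIcc_of_le hA.le] at hx
    exact hx.1

/-- **Mellin integration by parts on the half-line.**  `f` differentiable on `(0,∞)`, continuous at `0`
from the right, `𝓜f(w)` absolutely convergent, `f'(x) x^w` integrable on `(0,∞)`, `f(x) x^{Re w} → 0`
at `∞`, `Re w > 0`: `w·𝓜f(w) = −∫_0^∞ f'(x) x^w dx`. [folklore] -/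
theorem mul_mellin_eq_neg_integral_deriv {f f' : ℝ → ℝ} (hcont : ContinuousWithinAt f (Ici 0) 0)
    (hderiv : ∀ x ∈ Ioi 0, HasDerivAt f (f' x) x) {w : ℂ} (hw : 0 < w.re)
    (hfw : MellinConvergent (fun x ↦ (f x : ℂ)) w)
    (hf'w : IntegrableOn (fun x : ℝ ↦ (f' x : ℂ) * (x : ℂ) ^ w) (Ioi 0))
    (hlim : Tendsto (fun x : ℝ ↦ f x * x ^ w.re) atTop (𝓝 0)) :
    w * mellin (fun x ↦ (f x : ℂ)) w = -∫ x in Ioi 0, (f' x : ℂ) * (x : ℂ) ^ w := by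
  have hw0 : w ≠ 0 := by
    rintro rfl
    simp at hw
  have hFcont : ContinuousWithinAt (fun x : ℝ ↦ (f x : ℂ) * (x : ℂ) ^ w) (Ici 0) 0 :=
    (Complex.continuous_ofReal.continuousAt.comp_continuousWithinAt hcont).mul
      (Complex.continuous_ofReal_cpow_const hw).continuousWithinAt
  have hFderiv : ∀ x ∈ Ioi (0 : ℝ), HasDerivAt (fun y : ℝ ↦ (f y : ℂ) * (y : ℂ) ^ w)
      ((f' x : ℂ) * (x : ℂ) ^ w + (f x : ℂ) * (w * (x : ℂ) ^ (w - 1))) x :=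
    fun x hx ↦ hasDerivAt_ofReal_mul_cpow hx (hderiv x hx) w
  have hI2 : IntegrableOn (fun x : ℝ ↦ (f x : ℂ) * (w * (x : ℂ) ^ (w - 1))) (Ioi 0) := by
    rw [MellinConvergent] at hfw
    refine (hfw.const_mul w).congr (ae_of_all _ fun x ↦ ?_)
    simp only [smul_eq_mul]
    ring
  have hFlim : Tendsto (fun x : ℝ ↦ (f x : ℂ) * (x : ℂ) ^ w) atTop (𝓝 0) := by
    rw [tendsto_zero_iff_norm_tendsto_zero]
    have h1 : Tendsto (fun x : ℝ ↦ |f x * x ^ w.re|) atTop (𝓝 0) := by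
      simpa using hlim.abs
    refine h1.congr' ?_
    filter_upwards [eventually_gt_atTop (0 : ℝ)] with x hx
    rw [norm_mul, Complex.norm_real, Real.norm_eq_abs, Complex.norm_cpow_eq_rpow_re_of_pos hx,
      abs_mul, abs_of_pos (Real.rpow_pos_of_pos hx _)]
  have hFTC := integral_Ioi_of_hasDerivAt_of_tendsto hFcont hFderiv (hf'w.add hI2) hFlim
  simp only [Complex.ofReal_zero, Complex.zero_cpow hw0, mul_zero, sub_zero] at hFTC
  rw [MeasureTheory.integral_add hf'w hI2] at hFTC
  have h2 : ∫ x in Ioi (0 : ℝ), (f x : ℂ) * (w * (x : ℂ) ^ (w - 1)) =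
      w * mellin (fun x ↦ (f x : ℂ)) w := by
    rw [mellin, ← MeasureTheory.integral_const_mul]
    refine setIntegral_congr_fun measurableSet_Ioi fun x _ ↦ ?_
    simp only [smul_eq_mul]
    ring
  rw [← h2]
  linear_combination hFTC

/-- Norm form of `mul_mellin_eq_neg_integral_deriv`: `‖w·𝓜f(w)‖ ≤ ∫_0^∞ |f'(x)| x^{Re w} dx`.
[folklore] -/
theorem norm_mul_mellin_le_of_hasDerivAt_Ioi {f f' : ℝ → ℝ} (hcont : ContinuousWithinAt f (Ici 0) 0)
    (hderiv : ∀ x ∈ Ioi 0, HasDerivAt f (f' x) x) {w : ℂ} (hw : 0 < w.re)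
    (hfw : MellinConvergent (fun x ↦ (f x : ℂ)) w)
    (hf'w : IntegrableOn (fun x : ℝ ↦ (f' x : ℂ) * (x : ℂ) ^ w) (Ioi 0))
    (hlim : Tendsto (fun x : ℝ ↦ f x * x ^ w.re) atTop (𝓝 0)) :
    ‖w * mellin (fun x ↦ (f x : ℂ)) w‖ ≤ ∫ x in Ioi 0, |f' x| * x ^ w.re := by
  rw [mul_mellin_eq_neg_integral_deriv hcont hderiv hw hfw hf'w hlim, norm_neg]
  refine (MeasureTheory.norm_integral_le_integral_norm _).trans (le_of_eq ?_)
  refine setIntegral_congr_fun measurableSet_Ioi fun x hx ↦ ?_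
  rw [norm_mul, Complex.norm_real, Real.norm_eq_abs, Complex.norm_cpow_eq_rpow_re_of_pos hx]

end Literature.NumberTheory.LFunctions
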